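import Summits.FinalStateConjecture.FinalStateConjecture.Theorems.EIHFluxBalanceInertialRecessionRechartCausalKit
import Summits.FinalStateConjecture.FinalStateConjecture.Theorems.EIHFluxBalanceInertialRecessionPullback
import Summits.FinalStateConjecture.FinalStateConjecture.Statement

/-!
# Route EIHFluxBalance — `InertialRecession`, re-charting: assembling the re-charted
# `FinalStateDecomposition` (core) for GENERAL spins and motions

Helper file for the crux `stmt-FinalStateConjecture-10166`
(`Summit.FinalStateConjecture.FinalStateConjecture.Theses.EIHFluxBalance.InertialRecession`),
stub `stub_rechart` (the transfer P2 of line `sublinear-is-free-clean-window-charges`), part G2.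

`exists_finalStateDecomposition_of_rechart_spin`: the statement of
`exists_finalStateDecomposition_of_rechart` (…RechartAssemblyCore, `a = 0`, motions `(boost Vᵢ, 0)`)
for arbitrary sub-extremal parameters `(Mᵢ, aᵢ)` and arbitrary motions `(Λᵢ, cᵢ)` (the lagged final
motions `(boost Vᵢ, s₀ᵢ • boost Vᵢ e₀)` of the clock charts), with `HasExhaustiveCharts` in its current
(audit-g6) form: certified radii `Rcᵢ → ∞` with the floor `max(r₊ᵢ, 0) + 1 ≤ Rcᵢ`. Given the lab chart
`Φ : U → 𝒟` with `O = J⁺(ι X) ∩ I⁻(Φ(E))`, hole charts `ψᵢ = Φ ∘ A'ᵢ` on the boosted exteriors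
(open embeddings, late, near-zone `C²` convergence for every radius and along `Rcᵢ`, eventual
disjointness), the flat package on `U₀ ⊆ U` and the TRANSFER (…RechartTransfer3 instantiated,
…RechartClockTransferClauses), it assembles `d : FinalStateDecomposition 𝒟 O′ 2`,
`O′ = exteriorOf charted′`, sub-extremality and `HasExhaustiveCharts d`. Pure bookkeeping. [folklore]
-/

noncomputable section

set_option linter.dupNamespace false

open scoped Topology ContDiff Manifold ENNReal
open Filter Set Topology Function TopologicalSpace Literature.Geometry.Lorentzian

namespace Summit.FinalStateConjecture.FinalStateConjecture.Theorems

section Core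

variable {X : Type} [TopologicalSpace X] [ChartedSpace E3 X] [IsManifold (𝓡 3) ∞ X]
  [ConnectedSpace X] {D : InitialDataSet (𝓡 3) X}

-- long bookkeeping proof
set_option maxHeartbeats 800000 in
/-- **Assembly of the re-charted decomposition (core), general spins and motions.** See the module
docstring. [folklore] -/
theorem exists_finalStateDecomposition_of_rechart_spin (𝒟 : VacuumCauchyDevelopment D) {N : ℕ}
    (M a : Fin N → ℝ) (hsub : ∀ i, Kerr.IsSubextremal (M i) (a i)) (Λm : Fin N → lorentzGroup)
    (cm : Fin N → E4)
    (U : Opens E4) (Φ : U → 𝒟.carrier) (hΦ : ContMDiff 𝓘(ℝ, E4) (𝓡 4) ∞ Φ)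
    (O : Set 𝒟.carrier) (Pext : U → Prop) {τ₀ τ₀' : ℝ} (hτ : τ₀ < τ₀')
    (hO : O = 𝒟.metric.causalFuture 𝒟.timeOrientation (range 𝒟.embed) ∩
      𝒟.metric.chronologicalPast 𝒟.timeOrientation (Φ '' {x : U | τ₀ < x.1 0 ∧ Pext x}))
    (himO : Φ '' {x : U | τ₀ < x.1 0 ∧ Pext x} ⊆ O)
    -- the hole charts
    (A : Fin N → E4 → E4) (hA : ∀ i, ContDiff ℝ ∞ (A i))
    (hAU : ∀ i, ∀ x ∈ (boostedKerrBackground (Λm i) (cm i) (M i) (a i)).domain, A i x ∈ U)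
    (hAlate : ∀ (i : Fin N) (y : (boostedKerrBackground (Λm i) (cm i) (M i) (a i)).domain),
      τ₀ < A i y.1 0 ∧ Pext ⟨A i y.1, hAU i y.1 y.2⟩)
    (hψemb : ∀ i, IsOpenEmbedding
      (fun y : (boostedKerrBackground (Λm i) (cm i) (M i) (a i)).domain ↦ Φ ⟨A i y.1, hAU i y.1 y.2⟩))
    (hconvR : ∀ (i : Fin N) (Rr : ℝ), Tendsto (fun τ ↦ 𝒟.toSpacetime.truncDeviationCk
      (boostedKerrBackground (Λm i) (cm i) (M i) (a i))
      (fun y ↦ Φ ⟨A i y.1, hAU i y.1 y.2⟩) 2 Rr τ) atTop (𝓝 0))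
    (Rc : Fin N → ℝ → ℝ) (hRctop : ∀ i, Tendsto (Rc i) atTop atTop)
    (hRcfloor : ∀ i τ, max (Kerr.rPlus (M i) (a i)) 0 + 1 ≤ Rc i τ)
    (hRc : ∀ i, Tendsto (fun τ ↦ 𝒟.toSpacetime.truncDeviationCk
      (boostedKerrBackground (Λm i) (cm i) (M i) (a i))
      (fun y ↦ Φ ⟨A i y.1, hAU i y.1 y.2⟩) 2 (Rc i τ) τ) atTop (𝓝 0))
    (hdisj : ∀ Rr : ℝ, ∃ τ₁ : ℝ, Pairwise (Function.onFun Disjoint fun i ↦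
      (fun y : (boostedKerrBackground (Λm i) (cm i) (M i) (a i)).domain ↦
        Φ ⟨A i y.1, hAU i y.1 y.2⟩) ''
        (boostedKerrBackground (Λm i) (cm i) (M i) (a i)).truncLateRegion τ₁ Rr))
    -- the flat chart
    (U₀ : Opens E4) (hU₀ : U₀ ≤ U) (ρexc : Fin N → ℝ → ℝ)
    (hexc : ∀ i, Tendsto (fun t ↦ ρexc i t / t) atTop (𝓝 0))
    (htube : {x : E4 | τ₀' < x 0 ∧ ∀ i, ρexc i (x 0) <
      Kerr.radius (a i) (poincareInv (Λm i) (cm i) x)} ⊆ (U₀ : Set E4))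
    (hflatdev : Tendsto (fun t ↦ 𝒟.toSpacetime.deviationCk (Minkowski.backgroundOn U₀)
      (Φ ∘ Opens.inclusion hU₀) 2 t) atTop (𝓝 0))
    (hflatemb : IsOpenEmbedding
      (((Minkowski.backgroundOn U₀).lateRegion τ₀').restrict (Φ ∘ Opens.inclusion hU₀)))
    (hU₀E : ∀ x : U₀, τ₀' < x.1 0 → Pext (Opens.inclusion hU₀ x))
    -- the transfer
    (htransfer : ∀ τ₁ : ℝ, τ₀' ≤ τ₁ →
      O ⊆ ((Φ ∘ Opens.inclusion hU₀) '' {x : U₀ | τ₁ < x.1 0} ∪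
          ⋃ i, (fun y : (boostedKerrBackground (Λm i) (cm i) (M i) (a i)).domain ↦
            Φ ⟨A i y.1, hAU i y.1 y.2⟩) ''
            {y | τ₁ < (boostedKerrBackground (Λm i) (cm i) (M i) (a i)).time y.1 ∧
              (boostedKerrBackground (Λm i) (cm i) (M i) (a i)).radius y.1 ≤
                Rc i ((boostedKerrBackground (Λm i) (cm i) (M i) (a i)).time y.1)}) ∪
        𝒟.metric.causalPast 𝒟.timeOrientation
          ((Φ ∘ Opens.inclusion hU₀) '' {x : U₀ | x.1 0 = τ₁} ∪
            ⋃ i, (fun y : (boostedKerrBackground (Λm i) (cm i) (M i) (a i)).domain ↦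
              Φ ⟨A i y.1, hAU i y.1 y.2⟩) ''
              (boostedKerrBackground (Λm i) (cm i) (M i) (a i)).truncTimeSlab (Rc i τ₁) τ₁)) :
    ∃ (O' : Set 𝒟.carrier) (d : FinalStateDecomposition 𝒟.toSpacetime O' 2),
      (∀ i, Kerr.IsSubextremal (d.mass i) (d.spin i)) ∧
        O' = Summit.FinalStateConjecture.exteriorOf 𝒟.toCauchyDevelopment d.charted ∧
          Summit.FinalStateConjecture.HasExhaustiveCharts d := by
  have hM : ∀ i, 0 < M i := fun i ↦ (abs_nonneg (a i)).trans_lt (hsub i)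
  -- notation
  set Kb : Fin N → ModelBackground := fun i ↦ boostedKerrBackground (Λm i) (cm i) (M i) (a i) with hKb
  set ψ : ∀ i, (Kb i).domain → 𝒟.carrier := fun i y ↦ Φ ⟨A i y.1, hAU i y.1 y.2⟩ with hψ
  set E : Set U := {x : U | τ₀ < x.1 0 ∧ Pext x} with hE
  set C' : Set 𝒟.carrier := (Φ ∘ Opens.inclusion hU₀) '' (Minkowski.backgroundOn U₀).lateRegion τ₀' ∪
    ⋃ i, ψ i '' (Kb i).lateRegion τ₀' with hC'
  set O' : Set 𝒟.carrier := Summit.FinalStateConjecture.exteriorOf 𝒟.toCauchyDevelopment C'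
    with hO'
  -- `C' ⊆ Φ(E)`, hence `O' ⊆ O`
  have hC'E : C' ⊆ Φ '' E := by
    rintro p (⟨x, hx, rfl⟩ | hp)
    · exact ⟨Opens.inclusion hU₀ x, ⟨hτ.trans hx, hU₀E x hx⟩, rfl⟩
    · obtain ⟨i, y, -, rfl⟩ := mem_iUnion.mp hp
      exact ⟨⟨A i y.1, hAU i y.1 y.2⟩, hAlate i y, rfl⟩
  have hO'O : O' ⊆ O := by
    rw [hO]
    exact inter_subset_inter_right _ (LorentzianMetric.chronologicalFuture_mono hC'E)
  have hOJ : O ⊆ 𝒟.metric.causalFuture 𝒟.timeOrientation (range 𝒟.embed) := by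
    rw [hO]; exact inter_subset_left
  -- `C'` is open
  have hlateo : ∀ (i) (τ : ℝ), IsOpen ((Kb i).lateRegion τ) := fun i τ ↦
    isOpen_lt continuous_const
      (((EuclideanSpace.proj (0 : Fin 4) : E4 →L[ℝ] ℝ).continuous.comp
        (continuous_poincareInv (Λm i) (cm i))).comp continuous_subtype_val)
  have hC'o : IsOpen C' := by
    refine IsOpen.union ?_ (isOpen_iUnion fun i ↦ (hψemb i).isOpenMap _ (hlateo i τ₀'))
    rw [← range_restrict]
    exact hflatemb.isOpen_range
  -- every part of `C'` lies in `O'`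
  have hpartO' : ∀ S : Set 𝒟.carrier, S ⊆ C' → S ⊆ O' := fun S hS ↦
    subset_inter (hS.trans (hC'E.trans (himO.trans hOJ)))
      (subset_chronologicalPast_of_subset_isOpen hC'o hS)
  have hholeO' : ∀ i, ψ i '' (Kb i).lateRegion τ₀' ⊆ O' := fun i ↦
    hpartO' _ ((subset_iUnion (fun i ↦ ψ i '' (Kb i).lateRegion τ₀') i).trans subset_union_right)
  have hflatO' : (Φ ∘ Opens.inclusion hU₀) '' (Minkowski.backgroundOn U₀).lateRegion τ₀' ⊆ O' :=
    hpartO' _ subset_union_left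
  -- the decomposition
  let d : FinalStateDecomposition 𝒟.toSpacetime O' 2 :=
    { N := N
      mass := M
      spin := a
      mass_pos := hM
      abs_spin_le_mass := fun i ↦ le_of_lt (hsub i)
      motion := fun i ↦ (Λm i, cm i)
      τ₀ := τ₀'
      chart := fun i ↦ ψ i
      isLateChart := fun i ↦ ⟨contMDiff_comp_smooth (hA i) (hAU i) (fun _ ↦ rfl) hΦ,
        (hψemb i).comp (hlateo i τ₀').isOpenEmbedding_subtypeVal, hholeO' i⟩
      tendsto_truncDeviationCk := fun i Rr ↦ hconvR i Rr
      exists_pairwise_disjoint := hdisj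
      excision := ρexc
      tendsto_excision_div := hexc
      flatDomain := U₀
      setOf_lt_excision_subset_flatDomain := htube
      flatChart := Φ ∘ Opens.inclusion hU₀
      isLateChart_flat := ⟨hΦ.comp (contMDiff_inclusion hU₀), hflatemb, hflatO'⟩
      tendsto_deviationCk_flat := hflatdev
      diff_subset_causalPast := by
        intro p hp
        rcases htransfer τ₀' le_rfl (hO'O hp.1) with hl | hJ
        · -- certified-late points are charted-late
          exfalso
          refine hp.2 ?_
          rcases hl with ⟨x, hx, rfl⟩ | hl
          · exact Or.inr ⟨x, hx, rfl⟩
          · obtain ⟨i, y, ⟨hy1, -⟩, rfl⟩ := mem_iUnion.mp hl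
            exact Or.inl (mem_iUnion.mpr ⟨i, y, hy1, rfl⟩)
        · refine LorentzianMetric.causalFuture_mono ?_ hJ
          rintro q (⟨x, hx, rfl⟩ | hq)
          · exact Or.inr ⟨x, hx, rfl⟩
          · obtain ⟨i, y, hy, rfl⟩ := mem_iUnion.mp hq
            exact Or.inl (mem_iUnion.mpr ⟨i, y, hy.1, rfl⟩) }
  refine ⟨O', d, fun i ↦ hsub i, ?_, ⟨Rc, fun i ↦ ⟨hRctop i, hRcfloor i⟩, hRc, fun τ₁ hτ₁ ↦ ?_⟩⟩
  · -- `O' = J⁺(ι X) ∩ I⁻(d.charted)`: `d.charted = C'`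
    have hch : d.charted = C' := by
      show (Φ ∘ Opens.inclusion hU₀) '' (Minkowski.backgroundOn U₀).lateRegion τ₀' ∪
        ⋃ i, ψ i '' (Kb i).lateRegion τ₀' = C'
      rfl
    rw [hch]
  · -- exhaustion at chart time `τ₁ > τ₀'`
    intro p hp
    have hτ₁' : τ₀' ≤ τ₁ := le_of_lt hτ₁
    rcases htransfer τ₁ hτ₁' (hO'O hp.1) with hl | hJ
    · exact absurd hl hp.2
    · exact hJ

end Core

/-- Registered one-line form (stub `mass_pos_of_isSubextremal_rechart` of the crux item): a
sub-extremal hole has positive mass. [folklore] -/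
theorem mass_pos_of_isSubextremal_rechart : open Literature.Geometry.Lorentzian in ∀ {M a : ℝ}, Kerr.IsSubextremal M a → 0 < M :=
  fun {_ a} h ↦ (abs_nonneg a).trans_lt h

end Summit.FinalStateConjecture.FinalStateConjecture.Theorems

end
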